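import Summits.PneNP.GCT.Max.KYCannotSeparatePaddedPerThreeFromFive
import Summits.PneNP.GCT.Max.DetKYLeadingTermsTwoCount
import HarnessLib
import HarnessLib.Audit

/-!
# `GCT/Max`: N-F-1 AT `n = 4` — plain Koszul–Young flattenings do not separate the padded `3 × 3` permanent `X₀₀·per₃` from `det₄`,
# PROVED WITHOUT CERTIFICATES; hence N-F-1 for EVERY `n ≥ 4` (`KYCannotSeparatePaddedPerThree`) is a theorem of the tree

Cell `pub-gct-max` (HOME `run/shared/lean/pub/pub-gct-max/`), track F; theory-2 gen 27 (memo `FINDINGS-LT2.md` §4, W2b at the cell (3,4)).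

`Max/KYCannotSeparatePaddedPerThreeFromFive.lean` proves N-F-1 (`rank KY_{p,k}(X₀₀^{n-3}·per₃) ≤ rank KY_{p,k}(det_n)` for every `(p,k)`)
for every `n ≥ 5` and splits off the `n = 4` slice as the OBLIGATION node `KYCannotSeparatePaddedPerThreeAtFour` (`@[conjecture]`: until now
certified only outside Lean by engine-3's exact-rank certificates, job j175878), because its cell inequality `cellBound 4 p k ≤ cellMax 4 p k`
(padded-side no-syzygy bound vs. the ONE-FAMILY leading-term count `max(LT, LT^dual)` of `det₄`) FAILS at 18 of the 64 cells: the nine primal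
cells `k = 1`, `4 ≤ p ≤ 12` and their nine duals `k = 2`, `3 ≤ p ≤ 11`.

This module closes those 18 cells with the ORDER-OPTIMISED leading-label count of `Max/DetKYLeadingTermsTwo.lean`
(`DetKYLeadingTermBoundTwo`): `boundS 16 p 1 ≤ LT2_σ(4, p, 1) ≤ rank KY_{p,1}(det₄)` for `p = 4, …, 12` — nine kernel evaluations (`decide +kernel`,
≈ 20 s each) of the inclusion–exclusion form `lt2IE` (`Max/DetKYLeadingTermsTwoCount.lean`, `LT2InclusionExclusion`), in row-major order `σ = 1`
at eight cells (e.g. `p = 8`: `boundS = 128 700 ≤ LT2₁ = 143 003`, where `max(LT, LT^dual) = 86 190` failed) and in the diagonal-sweep order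
`σ = diagSweep 4` at `p = 10` (row-major gives `77 660 < 80 080 = boundS`; the sweep gives `98 724`) — plus the transpose duality of `det₄`
(`DetKYLeadingTerms.kyRank_detPoly_dual`) for the nine dual cells. The other 46 cells are the cell inequality of the `FromFive` file at `n = 4`
(kernel `decide` on its mirrors). Consequences (PROVED here): `kyCannotSeparatePaddedPerThreeAtFour_holds : KYCannotSeparatePaddedPerThreeAtFour`
and, through the tree's edge `atFourImpliesCannotSeparate_holds`, `kyCannotSeparatePaddedPerThree_holds : KYCannotSeparatePaddedPerThree` —
N-F-1 for every `n ≥ 4`: no plain Koszul–Young flattening `Λ^p ⊗ S^k` separates `X₀₀^{n-3}·per₃` from `det_n`, for any `n`.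

HONEST FRAMING: a LOCATED NEGATIVE about ONE family of equations (plain Koszul–Young flattenings) for the padded `3 × 3` permanent, now
certificate-free at every `n`; it re-derives nothing about `dc(per₃) = 7` / `\overline{dc}(per₃) ≥ 5` (known in print) and is not a statement about
other Young flattenings, border apolarity or multiplicity obstructions; occurrence obstructions are ruled out in print (BIP'16) — multiplicity
obstructions are the open door; nothing here is a claim on VP vs VNP or P vs NP.

## References (statements as printed: `HOME/typed/AS-PRINTED-2.md` §F)
* [LandsbergGCT2017] §8.2.1 eq. (8.2.1), Prop. 8.2.1.1 (Koszul–Young flattenings), §6.6 (`\overline{dc}(per₃) ≥ 5`).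
* [EfremenkoLandsbergSchenckWeyman2018] §1.1, Rem. 1.3–1.4.  * [AlperBogartVelasco2017] (`dc(per₃) = 7`).
-/

namespace Summit.PneNP.GCT

open Literature.Computability.AlgebraicComplexity Literature.Barriers.ValiantsHypothesis

namespace NF1AtFour

open Finset SF6Stage3 DetKYLeadingTermsTwo

/-! ## The nine primal `k = 1` cells by the leading-label count `LT2_σ(4, p, 1)` (kernel evaluation of `lt2IE`; row-major `σ = 1` except at `p = 10`) -/

/-- The diagonal-sweep order `ω_diag` (memo FINDINGS-LT2 §2, the numerically best order at `n ≤ 7`): the rank of the position `(r, c)` is the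
row-major number of `((c - r) mod n, r)`. As a permutation of `Fin (n*n)`: un-number, shear `(r, c) ↦ (r, c - r)`, swap, re-number. [folklore] -/
def diagSweep (n : ℕ) [NeZero n] : Equiv.Perm (Fin (n * n)) :=
  ((finProdFinEquiv.symm.trans (((Equiv.refl (Fin n)).prodShear fun r => Equiv.subRight r).trans
    (Equiv.prodComm (Fin n) (Fin n)))).trans finProdFinEquiv)


/-- Cell `(p, k) = (4, 1)`, row-major order. [folklore] -/
theorem k1_p4 : ((boundSD 16 4 1 : ℕ) : ℤ) ≤ lt2IE 4 4 1 1 := by decide +kernel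
/-- Cell `(p, k) = (5, 1)`, row-major order. [folklore] -/
theorem k1_p5 : ((boundSD 16 5 1 : ℕ) : ℤ) ≤ lt2IE 4 5 1 1 := by decide +kernel
/-- Cell `(p, k) = (6, 1)`, row-major order. [folklore] -/
theorem k1_p6 : ((boundSD 16 6 1 : ℕ) : ℤ) ≤ lt2IE 4 6 1 1 := by decide +kernel
/-- Cell `(p, k) = (7, 1)`, row-major order. [folklore] -/
theorem k1_p7 : ((boundSD 16 7 1 : ℕ) : ℤ) ≤ lt2IE 4 7 1 1 := by decide +kernel
/-- Cell `(p, k) = (8, 1)`, row-major order. [folklore] -/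
theorem k1_p8 : ((boundSD 16 8 1 : ℕ) : ℤ) ≤ lt2IE 4 8 1 1 := by decide +kernel
/-- Cell `(p, k) = (9, 1)`, row-major order. [folklore] -/
theorem k1_p9 : ((boundSD 16 9 1 : ℕ) : ℤ) ≤ lt2IE 4 9 1 1 := by decide +kernel
/-- At `p = 10` (`c = 5`) the row-major count `77 660` falls short of `boundS = 80 080`; the diagonal sweep `ω_diag`
(`diagSweep`) gives `98 724`. [folklore] -/
theorem k1_p10 : ((boundSD 16 10 1 : ℕ) : ℤ) ≤ lt2IE 4 10 1 (diagSweep 4) := by decide +kernel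
/-- Cell `(p, k) = (11, 1)`, row-major order. [folklore] -/
theorem k1_p11 : ((boundSD 16 11 1 : ℕ) : ℤ) ≤ lt2IE 4 11 1 1 := by decide +kernel
/-- Cell `(p, k) = (12, 1)`, row-major order. [folklore] -/
theorem k1_p12 : ((boundSD 16 12 1 : ℕ) : ℤ) ≤ lt2IE 4 12 1 1 := by decide +kernel

/-- Hence `boundS 16 p 1 ≤ rank KY_{p,1}(det₄)` for `4 ≤ p ≤ 12` (`boundS ≤ LT2_σ = lt2IE ≤ rank`, `LT2InclusionExclusion` and
`DetKYLeadingTermBoundTwo`). [folklore] -/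
theorem boundS_le_kyRank_detFour (p : ℕ) (h4 : 4 ≤ p) (h12 : p ≤ 12) :
    boundS 16 p 1 ≤ kyRank ℂ p 1 (detPoly (Fin 4) ℂ) := by
  rw [← boundSD_eq]
  interval_cases p
  exacts [le_kyRank_detPoly_of_le_lt2IE ℂ (by norm_num) _ k1_p4, le_kyRank_detPoly_of_le_lt2IE ℂ (by norm_num) _ k1_p5,
    le_kyRank_detPoly_of_le_lt2IE ℂ (by norm_num) _ k1_p6, le_kyRank_detPoly_of_le_lt2IE ℂ (by norm_num) _ k1_p7,
    le_kyRank_detPoly_of_le_lt2IE ℂ (by norm_num) _ k1_p8, le_kyRank_detPoly_of_le_lt2IE ℂ (by norm_num) _ k1_p9,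
    le_kyRank_detPoly_of_le_lt2IE ℂ (by norm_num) _ k1_p10, le_kyRank_detPoly_of_le_lt2IE ℂ (by norm_num) _ k1_p11,
    le_kyRank_detPoly_of_le_lt2IE ℂ (by norm_num) _ k1_p12]

/-! ## The other 46 cells: the `FromFive` cell inequality holds at `n = 4` outside the 18 listed cells (kernel `decide` on its mirrors) -/

/-- At `n = 4` the cell inequality (on the kernel mirrors) holds outside `k = 1`, `4 ≤ p ≤ 12` and `k = 2`, `3 ≤ p ≤ 11`. [folklore] -/
theorem cells : ∀ p < 16, ∀ k < 4, cellBoundD 4 p k ≤ cellMaxD 4 p k ∨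
    (k = 1 ∧ 4 ≤ p ∧ p ≤ 12) ∨ (k = 2 ∧ 3 ≤ p ∧ p ≤ 11) := by
  decide

/-! ## The assembly at `n = 4` -/

/-- **N-F-1 at `n = 4`, every cell `(p, k)`.** [folklore] -/
theorem kyRank_paddedPerPoly_three_four_le (p k : ℕ) :
    kyRank ℂ p k (paddedPerPoly ℂ 3 4) ≤ kyRank ℂ p k (detPoly (Fin 4) ℂ) := by
  obtain ⟨hb, hbh, hz⟩ := paddedPerThreeKYUpperBounds_holds 4 p k (by omega)
  rcases Nat.lt_or_ge k 4 with hk | hk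
  swap
  · rw [hz hk]; exact Nat.zero_le _
  rcases Nat.lt_or_ge p 16 with hp | hp
  swap
  · have h0 : boundS (4 * 4) p k = 0 := by
      unfold boundS
      rw [Nat.choose_eq_zero_of_lt (by omega : 4 * 4 < p + 1)]
      simp
    rw [h0] at hb
    exact hb.trans (Nat.zero_le _)
  have hpN : p + 1 ≤ 4 * 4 := by omega
  have hkn : k + 1 ≤ 4 := hk
  -- determinant side, one family: `max(LT, LT^dual) ≤ rank KY_{p,k}(det₄)`
  have hdetmax : cellMax 4 p k ≤ kyRank ℂ p k (detPoly (Fin 4) ℂ) := detKYLeadingTermBound_holds 4 p k hpN hkn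
  -- padded side: the bound at the primal or the dual cell
  have hpad : kyRank ℂ p k (paddedPerPoly ℂ 3 4) ≤ cellBound 4 p k := by
    unfold cellBound
    split_ifs with hks
    · exact hb
    · have h := hbh
      rw [show 4 - (k + 1) = 4 - 1 - k by omega] at h
      unfold boundS
      rw [show 4 * 4 - 1 - p = 4 * 4 - (p + 1) by omega, Nat.choose_symm (show p + 1 ≤ 4 * 4 by omega),
        show 4 * 4 - (p + 1) + 1 = 4 * 4 - p by omega, Nat.choose_symm (show p ≤ 4 * 4 by omega),
        show 4 - 1 - k + 1 = 4 - k by omega, min_comm]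
      exact h
  rcases cells p hp k hk with hgood | ⟨rfl, h4, h12⟩ | ⟨rfl, h3, h11⟩
  · rw [cellBoundD_eq, cellMaxD_eq] at hgood
    exact hpad.trans (hgood.trans hdetmax)
  · -- primal cell `k = 1`: the leading-label count `LT2_σ(4, p, 1)`
    have hcb : cellBound 4 p 1 = boundS 16 p 1 := by unfold cellBound; norm_num
    rw [hcb] at hpad
    exact hpad.trans (boundS_le_kyRank_detFour p h4 h12)
  · -- dual cell `k = 2`: padded bound at the dual cell `(15 - p, 1)`, then the transpose duality of `det₄`
    have hcb : cellBound 4 p 2 = boundS 16 (15 - p) 1 := by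
      unfold cellBound; norm_num
    rw [hcb] at hpad
    rw [DetKYLeadingTerms.kyRank_detPoly_dual ℂ 4 p 2 hpN hkn]
    have h := boundS_le_kyRank_detFour (15 - p) (by omega) (by omega)
    rw [show 4 * 4 - 1 - p = 15 - p by omega, show 4 - 1 - 2 = 1 by norm_num]
    exact hpad.trans h

end NF1AtFour

/-! ## The node and its consequence (PROVED) -/

/-- **N-F-1 at `n = 4` holds** — the obligation node `KYCannotSeparatePaddedPerThreeAtFour` of `Max/KYCannotSeparatePaddedPerThreeFromFive.lean`,
now proved in Lean (no certificates). [folklore] -/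
theorem kyCannotSeparatePaddedPerThreeAtFour_holds : KYCannotSeparatePaddedPerThreeAtFour :=
  fun p k => NF1AtFour.kyRank_paddedPerPoly_three_four_le p k

/-- **N-F-1 for every `n ≥ 4`** (`KYCannotSeparatePaddedPerThree`, `Conjectures/KYFlatteningBlindPaddedPerThree.lean`): no plain Koszul–Young
flattening separates `X₀₀^{n-3}·per₃` from `det_n` — `n = 4` here, `n ≥ 5` by `kyCannotSeparatePaddedPerThreeFromFive_holds`, glued by the tree's
edge `atFourImpliesCannotSeparate_holds`. [folklore] -/
theorem kyCannotSeparatePaddedPerThree_holds : KYCannotSeparatePaddedPerThree :=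
  atFourImpliesCannotSeparate_holds kyCannotSeparatePaddedPerThreeAtFour_holds

end Summit.PneNP.GCT
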